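import Summits.AtomisticToContinuum.FouriersLaw.Theorems.BondHeatUncertaintySubdiffusiveBondHeatKernelDetailedBalanceLaplaceC
import Summits.AtomisticToContinuum.FouriersLaw.Theorems.BondHeatUncertaintySubdiffusiveBondHeatResolventRangeDense
import Summits.AtomisticToContinuum.FouriersLaw.Theorems.BondHeatUncertaintySubdiffusiveBondHeatDenseOfOrthogonal
import Summits.AtomisticToContinuum.FouriersLaw.Theorems.BondHeatUncertaintySubdiffusiveBondHeatLaplaceUnique

/-!
# Kernel detailed balance (H2), part D: the Laplace identity unconditionally, and (H2) for test functions

Support for the registered stub `stub_kernelDetailedBalance` (H2) of crux `stmt-AtomisticToContinuum-9120`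
(`BondHeatUncertainty.SubdiffusiveBondHeat`, line `bath-bond-deficit-integral`). Assembly of the sub-stubs of the plan:

* `pinnedChain_range_dense_approx` — **`(λ - L)C_c^∞` is `L²(μ_T)`-dense** in approximation form: from the orthogonality form
  `stub_resolventRangeDense` (hypoelliptic regularity + energy estimate) and the Hilbert-space bridge `stub_denseOfOrthogonal`,
  applied to the submodule `{λb - Lb : b ∈ C_c^∞}` (linearity of `L` on `C²`, `sdeGenerator_add'`/`sdeGenerator_const_mul`);
* `pinnedChain_laplaceDetailedBalance`, `stub_laplaceDetailedBalance` (registered) — **`B_λ(f,h) = B_λ(h∘Θ, f∘Θ)`** for all test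
  `f, h` and `λ > 0` (part C + density);
* `pinnedChain_detailedBalance_test` — **(H2) for test functions**: `⟨f, P_u h⟩_{μ_T} = ⟨h∘Θ, P_u(f∘Θ)⟩_{μ_T}` for every `u ≥ 0`,
  by uniqueness of the Laplace transform of the bounded continuous difference (`stub_laplaceUnique`).
-/

noncomputable section

open MeasureTheory ProbabilityTheory Filter Topology Set Function
open scoped NNReal ENNReal ContDiff
open Literature.MathematicalPhysics.KineticTheory.HeatConduction
open Literature.MathematicalPhysics.KineticTheory OscillatorChain
open Summit.AtomisticToContinuum.FouriersLaw.Theorems.OddSectorIrreversibility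
open Summit.AtomisticToContinuum.FouriersLaw.Cruxes.SuperadditiveResistance.FloatingProbeBypassLaplacian

namespace Summit.AtomisticToContinuum.FouriersLaw.Theorems.SubdiffusiveBondHeat

variable {N : ℕ}

section Pinned

variable {ω₂ lam β γ : ℝ} (hω : 0 < ω₂) (hl : 0 < lam) (hβ : 0 < β) (hγ : 0 < γ) (hN : 0 < N)
  {T : ℝ} (hT : 0 < T)
include hω hl hβ hγ hN hT

/-! ### Linearity of the generator on `C²` -/

omit hω hl hβ in
/-- `L(f + g) = Lf + Lg` on `C²` for the pinned chain (through `sdeGenerator`). [folklore] -/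
theorem pinnedChain_generator_add {f g : PhaseSpace N → ℝ} (hf : ContDiff ℝ 2 f) (hg : ContDiff ℝ 2 g) :
    (pinnedChain ω₂ lam β γ).generator N T T (fun y => f y + g y) =
      fun y => (pinnedChain ω₂ lam β γ).generator N T T f y + (pinnedChain ω₂ lam β γ).generator N T T g y := by
  have hγT : 0 ≤ (pinnedChain ω₂ lam β γ).γ * T := mul_nonneg hγ.le hT.le
  rw [← (pinnedChain ω₂ lam β γ).sdeGenerator_drift_eq_generator hN hγT hγT (hf.add hg),
    ← (pinnedChain ω₂ lam β γ).sdeGenerator_drift_eq_generator hN hγT hγT hf,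
    ← (pinnedChain ω₂ lam β γ).sdeGenerator_drift_eq_generator hN hγT hγT hg]
  funext y
  exact sdeGenerator_add' _ _ _ hf hg y

omit hω hl hβ in
/-- `L(c f) = c Lf` on `C²` for the pinned chain. [folklore] -/
theorem pinnedChain_generator_const_mul {f : PhaseSpace N → ℝ} (hf : ContDiff ℝ 2 f) (c : ℝ) :
    (pinnedChain ω₂ lam β γ).generator N T T (fun y => c * f y) =
      fun y => c * (pinnedChain ω₂ lam β γ).generator N T T f y := by
  have hγT : 0 ≤ (pinnedChain ω₂ lam β γ).γ * T := mul_nonneg hγ.le hT.le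
  rw [← (pinnedChain ω₂ lam β γ).sdeGenerator_drift_eq_generator hN hγT hγT (contDiff_const.mul hf),
    ← (pinnedChain ω₂ lam β γ).sdeGenerator_drift_eq_generator hN hγT hγT hf]
  funext y
  exact sdeGenerator_const_mul _ _ _ hf c y

/-! ### Density of `(λ - L)C_c^∞` in approximation form -/

/-- **`(λ - L)C_c^∞` is `L²(μ_T)`-dense, approximation form**: for `λ > 0`, every test function `k` and `δ > 0` there is a test
function `b` with `∫ (k - (λb - Lb))² dμ_T ≤ δ` (orthogonality form `stub_resolventRangeDense` + `stub_denseOfOrthogonal` on the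
submodule `{λb - Lb}`). [cite: ReyBellet2006, Lemma 4.2] -/
theorem pinnedChain_range_dense_approx {lam' : ℝ} (hlam : 0 < lam') {k : PhaseSpace N → ℝ} (hk : ContDiff ℝ ∞ k)
    (hkc : HasCompactSupport k) {δ : ℝ} (hδ : 0 < δ) :
    ∃ b : PhaseSpace N → ℝ, ContDiff ℝ ∞ b ∧ HasCompactSupport b ∧
      ∫ z, (k z - (lam' * b z - (pinnedChain ω₂ lam β γ).generator N T T b z)) ^ 2
        ∂((pinnedChain ω₂ lam β γ).gibbsMeasure N T) ≤ δ := by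
  haveI : IsProbabilityMeasure ((pinnedChain ω₂ lam β γ).gibbsMeasure N T) :=
    pinnedChain_isProbabilityMeasure_gibbsMeasure hω hl.le hβ.le γ N hT
  have hU1 : ContDiff ℝ 1 (pinnedChain ω₂ lam β γ).U := pinnedChain_contDiff_U ω₂ lam β γ
  have hV1 : ContDiff ℝ 1 (pinnedChain ω₂ lam β γ).V := pinnedChain_contDiff_V ω₂ lam β γ
  -- the range submodule `{λb - Lb : b ∈ C_c^∞}`
  let S : Submodule ℝ (PhaseSpace N → ℝ) :=
    { carrier := {g | ∃ b : PhaseSpace N → ℝ, ContDiff ℝ ∞ b ∧ HasCompactSupport b ∧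
        g = fun z => lam' * b z - (pinnedChain ω₂ lam β γ).generator N T T b z}
      add_mem' := by
        rintro _ _ ⟨b₁, hb₁, hc₁, rfl⟩ ⟨b₂, hb₂, hc₂, rfl⟩
        refine ⟨fun z => b₁ z + b₂ z, hb₁.add hb₂, hc₁.add hc₂, ?_⟩
        have hadd := pinnedChain_generator_add (ω₂ := ω₂) (lam := lam) (β := β) hγ hN hT
          (hb₁.of_le (by norm_cast)) (hb₂.of_le (by norm_cast))
        funext z
        rw [hadd]
        simp only [Pi.add_apply]
        ring
      zero_mem' := ⟨fun _ => 0, contDiff_const, HasCompactSupport.intro isCompact_empty (fun _ _ => rfl), by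
        funext z; simp⟩
      smul_mem' := by
        rintro c _ ⟨b, hb, hc, rfl⟩
        refine ⟨fun z => c * b z, contDiff_const.mul hb, hc.mul_left, ?_⟩
        have hmul := pinnedChain_generator_const_mul (ω₂ := ω₂) (lam := lam) (β := β) hγ hN hT
          (hb.of_le (by norm_cast)) c
        funext z
        rw [hmul]
        simp only [Pi.smul_apply, smul_eq_mul]
        ring }
  have hS1 : ∀ g ∈ S, Measurable g ∧ MemLp g 2 ((pinnedChain ω₂ lam β γ).gibbsMeasure N T) := by
    rintro _ ⟨b, hb, hbc, rfl⟩
    have hb2 : ContDiff ℝ 2 b := hb.of_le (by norm_cast)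
    have hLc : Continuous ((pinnedChain ω₂ lam β γ).generator N T T b) :=
      (pinnedChain ω₂ lam β γ).continuous_generator hU1 hV1 N T T hb2
    obtain ⟨Bb, hBb⟩ := hb.continuous.bounded_above_of_compact_support hbc
    obtain ⟨BL, hBL⟩ := hLc.bounded_above_of_compact_support ((pinnedChain ω₂ lam β γ).hasCompactSupport_generator N T T hb2 hbc)
    have hgc : Continuous fun z => lam' * b z - (pinnedChain ω₂ lam β γ).generator N T T b z :=
      (continuous_const.mul hb.continuous).sub hLc
    refine ⟨hgc.measurable, MemLp.of_bound hgc.aestronglyMeasurable (|lam'| * Bb + BL) (Eventually.of_forall fun z => ?_)⟩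
    have h1 : ‖lam' * b z‖ ≤ |lam'| * Bb := by
      rw [norm_mul, Real.norm_eq_abs]; exact mul_le_mul_of_nonneg_left (hBb z) (abs_nonneg _)
    exact (norm_sub_le _ _).trans (add_le_add h1 (hBL z))
  have hS2 : ∀ kk : PhaseSpace N → ℝ, Measurable kk → MemLp kk 2 ((pinnedChain ω₂ lam β γ).gibbsMeasure N T) →
      (∀ g ∈ S, ∫ x, g x * kk x ∂((pinnedChain ω₂ lam β γ).gibbsMeasure N T) = 0) →
        kk =ᵐ[(pinnedChain ω₂ lam β γ).gibbsMeasure N T] 0 := by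
    intro kk hkm hkL2 horth
    refine stub_resolventRangeDense ω₂ lam β γ hω hl hβ hγ T hT N hN lam' hlam kk hkm hkL2 fun F hF hFc => ?_
    exact horth _ ⟨F, hF, hFc, rfl⟩
  have hkL2 : MemLp k 2 ((pinnedChain ω₂ lam β γ).gibbsMeasure N T) := by
    obtain ⟨Bk, hBk⟩ := hk.continuous.bounded_above_of_compact_support hkc
    exact MemLp.of_bound hk.continuous.aestronglyMeasurable Bk (Eventually.of_forall hBk)
  obtain ⟨g, ⟨b, hb, hbc, rfl⟩, hgδ⟩ :=
    stub_denseOfOrthogonal N ((pinnedChain ω₂ lam β γ).gibbsMeasure N T) S hS1 hS2 k hk.continuous.measurable hkL2 δ hδ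
  exact ⟨b, hb, hbc, hgδ⟩

/-! ### The Laplace identity, unconditionally -/

/-- **`B_λ(f,h) = B_λ(h∘Θ, f∘Θ)`** for the pinned chain (`ω₂, lam, β, γ, T > 0`, `N ≥ 1`), every `λ > 0` and all test functions
`f, h`: `∫₀^∞ e^{-λt} ⟨f, P_t h⟩_{μ_T} dt = ∫₀^∞ e^{-λt} ⟨h∘Θ, P_t(f∘Θ)⟩_{μ_T} dt`. [cite: ReyBellet2006, Lemma 4.2] -/
theorem pinnedChain_laplaceDetailedBalance {lam' : ℝ} (hlam : 0 < lam') {f h : PhaseSpace N → ℝ}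
    (hf : ContDiff ℝ ∞ f) (hfc : HasCompactSupport f) (hh : ContDiff ℝ ∞ h) (hhc : HasCompactSupport h) :
    ∫ t in Ioi (0 : ℝ), Real.exp (-(lam' * t)) * ∫ z, f z * (∫ y, h y
        ∂((pinnedChain ω₂ lam β γ).transitionKernel N T T t.toNNReal z)) ∂((pinnedChain ω₂ lam β γ).gibbsMeasure N T) =
    ∫ t in Ioi (0 : ℝ), Real.exp (-(lam' * t)) * ∫ z, h (z.1, -z.2) * (∫ y, f (y.1, -y.2)
        ∂((pinnedChain ω₂ lam β γ).transitionKernel N T T t.toNNReal z)) ∂((pinnedChain ω₂ lam β γ).gibbsMeasure N T) :=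
  pinnedChain_laplaceDetailedBalance_of_dense hω hl.le hβ hγ hN hT hlam
    (fun _ hk hkc _ hδ => pinnedChain_range_dense_approx hω hl hβ hγ hN hT hlam hk hkc hδ) hf hfc hh hhc

/-! ### (H2) for test functions -/

omit hN in
/-- `u ↦ ⟨f, P_{u⁺} g⟩_{μ_T}` is continuous for bounded continuous `f, g`. [folklore] -/
theorem pinnedChain_continuous_corr₂ {f g : PhaseSpace N → ℝ} (hf : Continuous f) (hg : Continuous g) {Bf Bg : ℝ}
    (hBf : ∀ y, ‖f y‖ ≤ Bf) (hBg : ∀ y, ‖g y‖ ≤ Bg) :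
    Continuous fun u : ℝ => ∫ z, f z * (∫ y, g y ∂((pinnedChain ω₂ lam β γ).transitionKernel N T T u.toNNReal z))
      ∂((pinnedChain ω₂ lam β γ).gibbsMeasure N T) := by
  haveI : IsProbabilityMeasure ((pinnedChain ω₂ lam β γ).gibbsMeasure N T) :=
    pinnedChain_isProbabilityMeasure_gibbsMeasure hω hl.le hβ.le γ N hT
  have hBf0 : 0 ≤ Bf := (norm_nonneg _).trans (hBf 0)
  refine continuous_of_dominated (bound := fun _ => Bf * Bg) (fun u => ?_) (fun u => Eventually.of_forall fun z => ?_)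
    (integrable_const _) (Eventually.of_forall fun z => ?_)
  · exact hf.aestronglyMeasurable.mul (hg.stronglyMeasurable.integral_kernel
      (κ := (pinnedChain ω₂ lam β γ).transitionKernel N T T u.toNNReal)).aestronglyMeasurable
  · rw [norm_mul]
    exact mul_le_mul (hBf z) (pinnedChain_abs_act_le_of_bounded hω hl.le hβ hγ hBg _ z) (norm_nonneg _) hBf0
  · exact continuous_const.mul (pinnedChain_continuous_integral_transitionKernel_time hω hl.le hβ hγ hg hBg z)

omit hN in
/-- `|⟨f, P_u g⟩_{μ_T}| ≤ B_f B_g` for bounded `f, g`. [folklore] -/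
theorem pinnedChain_abs_corr_le {f g : PhaseSpace N → ℝ} {Bf Bg : ℝ} (hBf : ∀ y, ‖f y‖ ≤ Bf) (hBg : ∀ y, ‖g y‖ ≤ Bg)
    (u : ℝ≥0) :
    |∫ z, f z * (∫ y, g y ∂((pinnedChain ω₂ lam β γ).transitionKernel N T T u z)) ∂((pinnedChain ω₂ lam β γ).gibbsMeasure N T)|
      ≤ Bf * Bg := by
  haveI : IsProbabilityMeasure ((pinnedChain ω₂ lam β γ).gibbsMeasure N T) :=
    pinnedChain_isProbabilityMeasure_gibbsMeasure hω hl.le hβ.le γ N hT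
  have hBf0 : 0 ≤ Bf := (norm_nonneg _).trans (hBf 0)
  have h := norm_integral_le_of_norm_le_const (μ := (pinnedChain ω₂ lam β γ).gibbsMeasure N T)
    (f := fun z => f z * (∫ y, g y ∂((pinnedChain ω₂ lam β γ).transitionKernel N T T u z))) (C := Bf * Bg)
    (Eventually.of_forall fun z => by
      rw [norm_mul]
      exact mul_le_mul (hBf z) (pinnedChain_abs_act_le_of_bounded hω hl.le hβ hγ hBg _ z) (norm_nonneg _) hBf0)
  rw [Real.norm_eq_abs] at h
  simpa [probReal_univ] using h

/-- **Kernel detailed balance for test functions.** For the pinned chain (`ω₂, lam, β, γ, T > 0`, `N ≥ 1`), test functions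
`f, h` and every `u ≥ 0`: `∫ f · P_u h dμ_T = ∫ (h∘Θ) · P_u(f∘Θ) dμ_T`. Proof: the difference is a bounded continuous
function of `u ∈ [0,∞)` with vanishing Laplace transform (`pinnedChain_laplaceDetailedBalance`), hence zero
(`stub_laplaceUnique`). [cite: ReyBellet2006, Lemma 4.2] -/
theorem pinnedChain_detailedBalance_test {f h : PhaseSpace N → ℝ} (hf : ContDiff ℝ ∞ f) (hfc : HasCompactSupport f)
    (hh : ContDiff ℝ ∞ h) (hhc : HasCompactSupport h) (u : ℝ≥0) :
    ∫ z, f z * (∫ y, h y ∂((pinnedChain ω₂ lam β γ).transitionKernel N T T u z)) ∂((pinnedChain ω₂ lam β γ).gibbsMeasure N T) =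
      ∫ z, h (z.1, -z.2) * (∫ y, f (y.1, -y.2) ∂((pinnedChain ω₂ lam β γ).transitionKernel N T T u z))
        ∂((pinnedChain ω₂ lam β γ).gibbsMeasure N T) := by
  obtain ⟨Bf, hBf⟩ := hf.continuous.bounded_above_of_compact_support hfc
  obtain ⟨Bh, hBh⟩ := hh.continuous.bounded_above_of_compact_support hhc
  have hfΘ : Continuous fun z : PhaseSpace N => f (z.1, -z.2) := continuous_comp_flip hf.continuous
  have hhΘ : Continuous fun z : PhaseSpace N => h (z.1, -z.2) := continuous_comp_flip hh.continuous
  have hBfΘ : ∀ y : PhaseSpace N, ‖f (y.1, -y.2)‖ ≤ Bf := fun y => hBf _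
  have hBhΘ : ∀ y : PhaseSpace N, ‖h (y.1, -y.2)‖ ≤ Bh := fun y => hBh _
  -- the difference of the two correlations as a function of real time
  set φ : ℝ → ℝ := fun s =>
    (∫ z, f z * (∫ y, h y ∂((pinnedChain ω₂ lam β γ).transitionKernel N T T s.toNNReal z))
        ∂((pinnedChain ω₂ lam β γ).gibbsMeasure N T)) -
      ∫ z, h (z.1, -z.2) * (∫ y, f (y.1, -y.2) ∂((pinnedChain ω₂ lam β γ).transitionKernel N T T s.toNNReal z))
        ∂((pinnedChain ω₂ lam β γ).gibbsMeasure N T) with hφ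
  have hφc : Continuous φ :=
    (pinnedChain_continuous_corr₂ hω hl hβ hγ hT hf.continuous hh.continuous hBf hBh).sub
      (pinnedChain_continuous_corr₂ hω hl hβ hγ hT hhΘ hfΘ hBhΘ hBfΘ)
  have hφb : ∃ C : ℝ, ∀ s, 0 ≤ s → |φ s| ≤ C := by
    refine ⟨Bf * Bh + Bh * Bf, fun s _ => ?_⟩
    have h1 := pinnedChain_abs_corr_le hω hl hβ hγ hT hBf hBh s.toNNReal
    have h2 := pinnedChain_abs_corr_le hω hl hβ hγ hT hBhΘ hBfΘ s.toNNReal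
    simp only [hφ]
    exact (abs_sub _ _).trans (add_le_add h1 h2)
  have hlap : ∀ lam' : ℝ, 0 < lam' → ∫ s in Set.Ioi (0 : ℝ), Real.exp (-(lam' * s)) * φ s = 0 := by
    intro lam' hlam
    have I1 := pinnedChain_integrableOn_lapIntegrand hω hl.le hβ hγ hf.continuous hh.continuous
      (fun v => pinnedChain_corr_abs_le_weighted hω hl.le hβ hγ hN hT hf.continuous hh.continuous hBf hBh v one_pos) hlam
    have I2 := pinnedChain_integrableOn_lapIntegrand hω hl.le hβ hγ hhΘ hfΘ
      (fun v => pinnedChain_corr_abs_le_weighted hω hl.le hβ hγ hN hT hhΘ hfΘ hBhΘ hBfΘ v one_pos) hlam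
    have key := pinnedChain_laplaceDetailedBalance hω hl hβ hγ hN hT hlam hf hfc hh hhc
    simp only [hφ, mul_sub]
    rw [integral_sub I1 I2, key, sub_self]
  have h0 := stub_laplaceUnique φ hφc.continuousOn hφb hlap u u.2
  simp only [hφ, Real.toNNReal_coe] at h0
  exact sub_eq_zero.1 h0

end Pinned

/-- Registered sub-stub `stub_laplaceDetailedBalance` of crux stmt-AtomisticToContinuum-9120 (= `pinnedChain_laplaceDetailedBalance`
in closed form): the Laplace-transformed kernel detailed balance for test functions. [cite: ReyBellet2006, Lemma 4.2] -/
theorem stub_laplaceDetailedBalance : ∀ ω₂ lam β γ : ℝ, 0 < ω₂ → 0 < lam → 0 < β → 0 < γ → ∀ T : ℝ, 0 < T → ∀ (N : ℕ), 0 < N → ∀ lam' : ℝ, 0 < lam' → ∀ f h : PhaseSpace N → ℝ, ContDiff ℝ ((⊤ : ℕ∞) : WithTop ℕ∞) f → HasCompactSupport f → ContDiff ℝ ((⊤ : ℕ∞) : WithTop ℕ∞) h → HasCompactSupport h → ∫ s in Set.Ioi (0 : ℝ), Real.exp (-(lam' * s)) * ∫ y, f y * (∫ y', h y' ∂((pinnedChain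 ω₂ lam β γ).transitionKernel N T T s.toNNReal y)) ∂((pinnedChain ω₂ lam β γ).gibbsMeasure N T) = ∫ s in Set.Ioi (0 : ℝ), Real.exp (-(lam' * s)) * ∫ y, h (y.1, -y.2) * (∫ y', f (y'.1, -y'.2) ∂((pinnedChain ω₂ lam β γ).transitionKernel N T T s.toNNReal y)) ∂((pinnedChain ω₂ lam β γ).gibbsMeasure N T) :=
  fun _ _ _ _ hω hl hβ hγ _ hT _ hN _ hlam _ _ hf hfc hh hhc =>
    pinnedChain_laplaceDetailedBalance hω hl hβ hγ hN hT hlam hf hfc hh hhc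

end Summit.AtomisticToContinuum.FouriersLaw.Theorems.SubdiffusiveBondHeat
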